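import Literature.Geometry.Lorentzian.KerrConvergence
import Literature.Geometry.Lorentzian.KerrSchildDivergence

/-!
# Route StarvedNecks — crux `NecksCertify`, line `two-cap-focusing-ledger`: seam surgery, preparation

Helper file for the registered stub `stub_seamSurgery` (N2): the elementary coordinate facts used
by the assembly (`seam_prep`) — the hole domains `{r > r₊}` contain `{r > R₁}` (`r₊ ≤ 2M ≤ R₁/50`),
radius-level sets stay in the domain, the COLLAR BOOKKEEPING (a point of the shell region
`Rg + 17/20 < r < Rg + 2` at hole time `> τ₁ + 1 + s` is flat-late and outside all tubes: clock lag,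
A5, A10), the tube alternative (`¬` outside all tubes ⇒ `r + 3 ≤ Rg`), and a point of the flat
domain; anchor `stub_seamSurgery_collarPoint` (registered helper sub-goal): the Kerr radius of the
coordinate point `(t, 0, 0, z)`, `z > 0`, is `z`.

Mathlib + `Literature.Geometry.Lorentzian.KerrConvergence` / `…KerrSchildDivergence`; no definitions,
no named facts.
-/

noncomputable section

open scoped Manifold ContDiff Topology ENNReal
open Filter Set Function Topology Literature.Geometry.Lorentzian

namespace Summit.FinalStateConjecture.FinalStateConjecture.Theorems.NecksCertifyTwoCap.Seam

set_option linter.dupNamespace false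

/-- Registered helper sub-goal `stub_seamSurgery_collarPoint` of N2 (anchor of this file): the Kerr
radius of the axis point `(t, 0, 0, z)` with `z > 0` is `z`. [folklore] -/
theorem stub_seamSurgery_collarPoint :
    ∀ (a t z : ℝ), 0 < z → Kerr.radius a (WithLp.toLp 2 ![t, 0, 0, z]) = z := by
  intro a t z hz
  refine Kerr.radius_eq_of_pos_of_quartic hz ?_
  rw [E4.spatialNorm_sq]
  simp
  ring

/-- **Preparation for the seam** (all holes): domain bookkeeping (`{r > R₁} ⊆ domain`, positivity
of `r` on the domain, radius-level sets stay in the domain), the collar bookkeeping (shell points at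
hole time `> τ₁ + 1 + s` are flat-late and outside all tubes — clock lag, A5, A10), the tube
alternative, and a point of the flat domain (on the collar of hole `0`, charted by A3). [folklore] -/
theorem seam_prep {𝓢 : Spacetime.{0} 4} {N : ℕ} (hN : 0 < N) (Λ : Fin N → lorentzGroup)
    (c : Fin N → E4) (M a : Fin N → ℝ) (hM : ∀ j, 0 < M j) (R₁ τ₁ τf : ℝ) (s : Fin N → ℝ)
    (hR₁ : ∀ j, 100 * M j ≤ R₁) (hs : ∀ j, 0 ≤ s j) (hτ : τf ≤ τ₁)
    (Rg : Fin N → ℝ → ℝ) (hRg4 : ∀ j t, R₁ + 4 ≤ Rg j t) (ρ' : Fin N → ℝ → ℝ)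
    (Ψ' : ∀ j, (boostedKerrBackground (Λ j) (c j) (M j) (a j)).domain → 𝓢.carrier) (W₀ : TopologicalSpace.Opens E4) (Φ : W₀ → 𝓢.carrier)
    (hA3 : ∀ j (y : E4) (hy : y ∈ (boostedKerrBackground (Λ j) (c j) (M j) (a j)).domain), τ₁ ≤ y 0 → (∀ j, ρ' j (y 0) < (boostedKerrBackground (Λ j) (c j) (M j) (a j)).radius y) →
      (boostedKerrBackground (Λ j) (c j) (M j) (a j)).radius y ≤ Rg j ((boostedKerrBackground (Λ j) (c j) (M j) (a j)).time y) + 2 → ∃ hw : y ∈ W₀, Ψ' j ⟨y, hy⟩ = Φ ⟨y, hw⟩)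
    (hA5 : ∀ j (y : E4), τ₁ ≤ y 0 → (boostedKerrBackground (Λ j) (c j) (M j) (a j)).radius y ≤ ρ' j (y 0) → (boostedKerrBackground (Λ j) (c j) (M j) (a j)).radius y + 3 ≤ Rg j ((boostedKerrBackground (Λ j) (c j) (M j) (a j)).time y))
    (hA10 : ∀ j j' (y : E4), j ≠ j' → τ₁ ≤ y 0 → (boostedKerrBackground (Λ j) (c j) (M j) (a j)).radius y ≤ Rg j ((boostedKerrBackground (Λ j) (c j) (M j) (a j)).time y) + 2 →
      Rg j' ((boostedKerrBackground (Λ j') (c j') (M j') (a j')).time y) + 2 <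
        (boostedKerrBackground (Λ j') (c j') (M j') (a j')).radius y)
    (hlag : ∀ j (y : E4), τ₁ ≤ (boostedKerrBackground (Λ j) (c j) (M j) (a j)).time y → (boostedKerrBackground (Λ j) (c j) (M j) (a j)).radius y ≤ Rg j ((boostedKerrBackground (Λ j) (c j) (M j) (a j)).time y) + 2 → (boostedKerrBackground (Λ j) (c j) (M j) (a j)).time y - s j ≤ y 0) :
    0 < R₁ + 4 ∧
    (∀ j (y : E4), R₁ + 4 < (boostedKerrBackground (Λ j) (c j) (M j) (a j)).radius y → y ∈ (boostedKerrBackground (Λ j) (c j) (M j) (a j)).domain) ∧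
    (∀ j (y : E4), R₁ < (boostedKerrBackground (Λ j) (c j) (M j) (a j)).radius y → y ∈ (boostedKerrBackground (Λ j) (c j) (M j) (a j)).domain) ∧
    (∀ j (y : E4), y ∈ (boostedKerrBackground (Λ j) (c j) (M j) (a j)).domain → 0 < (boostedKerrBackground (Λ j) (c j) (M j) (a j)).radius y) ∧
    (∀ j (y y' : E4), (boostedKerrBackground (Λ j) (c j) (M j) (a j)).radius y' = (boostedKerrBackground (Λ j) (c j) (M j) (a j)).radius y → y ∈ (boostedKerrBackground (Λ j) (c j) (M j) (a j)).domain → y' ∈ (boostedKerrBackground (Λ j) (c j) (M j) (a j)).domain) ∧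
    (∀ j (y : E4), y ∈ (boostedKerrBackground (Λ j) (c j) (M j) (a j)).domain → τ₁ + 1 + s j < (boostedKerrBackground (Λ j) (c j) (M j) (a j)).time y →
      Rg j ((boostedKerrBackground (Λ j) (c j) (M j) (a j)).time y) + 17 / 20 < (boostedKerrBackground (Λ j) (c j) (M j) (a j)).radius y → (boostedKerrBackground (Λ j) (c j) (M j) (a j)).radius y < Rg j ((boostedKerrBackground (Λ j) (c j) (M j) (a j)).time y) + 2 →
      τ₁ ≤ y 0 ∧ τf < y 0 ∧ ∀ j, ρ' j (y 0) < (boostedKerrBackground (Λ j) (c j) (M j) (a j)).radius y) ∧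
    (∀ j (y : E4), y ∈ (boostedKerrBackground (Λ j) (c j) (M j) (a j)).domain → τ₁ ≤ y 0 → (boostedKerrBackground (Λ j) (c j) (M j) (a j)).radius y ≤ Rg j ((boostedKerrBackground (Λ j) (c j) (M j) (a j)).time y) + 2 →
      ¬ (∀ j, ρ' j (y 0) < (boostedKerrBackground (Λ j) (c j) (M j) (a j)).radius y) → (boostedKerrBackground (Λ j) (c j) (M j) (a j)).radius y + 3 ≤ Rg j ((boostedKerrBackground (Λ j) (c j) (M j) (a j)).time y)) ∧
    Nonempty W₀ := by
  have hR₁0 : 0 < R₁ := by have := hR₁ ⟨0, hN⟩; linarith [hM ⟨0, hN⟩]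
  have hR₁4 : 0 < R₁ + 4 := by linarith
  have hrp : ∀ j, Kerr.rPlus (M j) (a j) < R₁ := fun j ↦ by
    have h1 : Kerr.rPlus (M j) (a j) ≤ 2 * M j := by
      unfold Kerr.rPlus
      have h := Real.sqrt_le_sqrt (show M j ^ 2 - a j ^ 2 ≤ M j ^ 2 by nlinarith [sq_nonneg (a j)])
      rw [Real.sqrt_sq (hM j).le] at h
      linarith
    linarith [hR₁ j, hM j]
  have hdomR' : ∀ j (y : E4), R₁ < (boostedKerrBackground (Λ j) (c j) (M j) (a j)).radius y → y ∈ (boostedKerrBackground (Λ j) (c j) (M j) (a j)).domain := fun j y hy ↦ by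
    show poincareInv (Λ j) (c j) y ∈ Kerr.exterior (M j) (a j)
    rw [Kerr.mem_exterior]
    exact (max_lt (hrp j) hR₁0).trans hy
  have hdomR : ∀ j (y : E4), R₁ + 4 < (boostedKerrBackground (Λ j) (c j) (M j) (a j)).radius y → y ∈ (boostedKerrBackground (Λ j) (c j) (M j) (a j)).domain := fun j y hy ↦
    hdomR' j y (by linarith)
  have hdompos : ∀ j (y : E4), y ∈ (boostedKerrBackground (Λ j) (c j) (M j) (a j)).domain → 0 < (boostedKerrBackground (Λ j) (c j) (M j) (a j)).radius y := fun j y hy ↦ by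
    have hy' : poincareInv (Λ j) (c j) y ∈ Kerr.exterior (M j) (a j) := hy
    rw [Kerr.mem_exterior] at hy'
    exact (le_max_right _ _).trans_lt hy'
  have hdomeq : ∀ j (y y' : E4), (boostedKerrBackground (Λ j) (c j) (M j) (a j)).radius y' = (boostedKerrBackground (Λ j) (c j) (M j) (a j)).radius y → y ∈ (boostedKerrBackground (Λ j) (c j) (M j) (a j)).domain → y' ∈ (boostedKerrBackground (Λ j) (c j) (M j) (a j)).domain := by
    intro j y y' hr hy
    have hy1 : poincareInv (Λ j) (c j) y ∈ Kerr.exterior (M j) (a j) := hy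
    show poincareInv (Λ j) (c j) y' ∈ Kerr.exterior (M j) (a j)
    rw [Kerr.mem_exterior] at hy1 ⊢
    have hr' : Kerr.radius (a j) (poincareInv (Λ j) (c j) y') = Kerr.radius (a j) (poincareInv (Λ j) (c j) y) := hr
    rwa [hr']
  have hcollar : ∀ j (y : E4), y ∈ (boostedKerrBackground (Λ j) (c j) (M j) (a j)).domain → τ₁ + 1 + s j < (boostedKerrBackground (Λ j) (c j) (M j) (a j)).time y →
      Rg j ((boostedKerrBackground (Λ j) (c j) (M j) (a j)).time y) + 17 / 20 < (boostedKerrBackground (Λ j) (c j) (M j) (a j)).radius y → (boostedKerrBackground (Λ j) (c j) (M j) (a j)).radius y < Rg j ((boostedKerrBackground (Λ j) (c j) (M j) (a j)).time y) + 2 →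
      τ₁ ≤ y 0 ∧ τf < y 0 ∧ ∀ j, ρ' j (y 0) < (boostedKerrBackground (Λ j) (c j) (M j) (a j)).radius y := by
    intro i y _ hty hr1 hr2
    have hlag' := hlag i y (by linarith [hs i]) hr2.le
    have hy0 : τ₁ + 1 < y 0 := by linarith
    refine ⟨by linarith, by linarith, fun j ↦ ?_⟩
    by_contra hcon
    push Not at hcon
    by_cases hji : j = i
    · subst hji
      have := hA5 j y (by linarith) hcon
      linarith
    · have h10 := hA10 i j y (Ne.symm hji) (by linarith) hr2.le
      have := hA5 j y (by linarith) hcon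
      linarith
  have htube : ∀ j (y : E4), y ∈ (boostedKerrBackground (Λ j) (c j) (M j) (a j)).domain → τ₁ ≤ y 0 → (boostedKerrBackground (Λ j) (c j) (M j) (a j)).radius y ≤ Rg j ((boostedKerrBackground (Λ j) (c j) (M j) (a j)).time y) + 2 →
      ¬ (∀ j, ρ' j (y 0) < (boostedKerrBackground (Λ j) (c j) (M j) (a j)).radius y) → (boostedKerrBackground (Λ j) (c j) (M j) (a j)).radius y + 3 ≤ Rg j ((boostedKerrBackground (Λ j) (c j) (M j) (a j)).time y) := by
    intro i y _ hy0 hr hP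
    push Not at hP
    obtain ⟨j, hj⟩ := hP
    by_cases hji : j = i
    · subst hji; exact hA5 j y hy0 hj
    · have h10 := hA10 i j y (Ne.symm hji) hy0 hr
      have := hA5 j y hy0 hj
      linarith
  refine ⟨hR₁4, hdomR, hdomR', hdompos, hdomeq, hcollar, htube, ?_⟩
  -- a point of the flat domain (on the collar of hole `0`)
  set i : Fin N := ⟨0, hN⟩ with hi
  set t₀ : ℝ := τ₁ + 2 + s i with ht₀
  set z₀ : ℝ := Rg i t₀ + 1 with hz₀
  have hz₀pos : 0 < z₀ := by have := hRg4 i t₀; linarith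
  set pt : E4 := WithLp.toLp 2 ![t₀, 0, 0, z₀] with hpt
  have hpr : Kerr.radius (a i) pt = z₀ := stub_seamSurgery_collarPoint (a i) t₀ z₀ hz₀pos
  set y₀ : E4 := c i + ((Λ i : E4 ≃L[ℝ] E4)) pt with hy₀
  have hpy : poincareInv (Λ i) (c i) y₀ = pt := by simp [hy₀, poincareInv]
  have hty : (boostedKerrBackground (Λ i) (c i) (M i) (a i)).time y₀ = t₀ := by
    show poincareInv (Λ i) (c i) y₀ 0 = t₀; rw [hpy]; simp [hpt]
  have hry : (boostedKerrBackground (Λ i) (c i) (M i) (a i)).radius y₀ = z₀ := by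
    show Kerr.radius (a i) (poincareInv (Λ i) (c i) y₀) = z₀; rw [hpy, hpr]
  have hdom : y₀ ∈ (boostedKerrBackground (Λ i) (c i) (M i) (a i)).domain := hdomR i y₀ (by rw [hry, hz₀]; linarith [hRg4 i t₀])
  obtain ⟨h0, -, hP⟩ := hcollar i y₀ hdom (by rw [hty, ht₀]; linarith)
    (by rw [hry, hty, hz₀]; linarith) (by rw [hry, hty, hz₀]; linarith)
  obtain ⟨hw, -⟩ := hA3 i y₀ hdom h0 hP (by rw [hry, hty, hz₀]; linarith)
  exact ⟨⟨y₀, hw⟩⟩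

end Summit.FinalStateConjecture.FinalStateConjecture.Theorems.NecksCertifyTwoCap.Seam

end
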